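import Summits.Schanuel.Schanuel.Theorems.ZilberEacGraphSurfaceLogRootSeq
import HarnessLib

/-!
# Logarithmic strips, I: log-corrected roots in degree one (`α z₀ + β - μ L = 2πi N + c₀`,
# `e^{L} = z₀`) by the Banach fixed-point theorem

HONEST FRAMING.  Cell `pub-schanuel` (Zilber's Exponential-Algebraic Closedness, case ladder;
host summit Schanuel), seat 2, gen 17.  Root supply for the degree-one engines (fibre curves
`P(x₀, y₀) = 0` over a graph base, where the exponential points are governed by the zeros of the
ONE-variable exponential polynomial `P(z, e^z)` lying in logarithmic strips `Re z ≈ μ log|z|`; and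
non-split surfaces over lines): for `α ≠ 0`, `μ ∈ ℝ` and a large target `w`, the equation
`α z = w + μ L` with `e^{L} = z` has a solution near `w/α` — the map
`Φ(z) = ζ₂ + (μ/α) log(z/ζ₁)` (`ζ₁ = w/α`, `ζ₂ = (w + μ log ζ₁)/α`; the logarithm of `z/ζ₁ ≈ 1` is
the principal one, so no branch cut is met) is a `½`-contraction of the disc `|z - ζ₂| ≤ 1`
(`exists_lineRoot_log`); the size hypotheses hold at all large stages
(`eventually_lineRoot_log_hyp`); the sequence form `exists_lineRoot_log_seq`.  NOT Schanuel's
conjecture (neither used nor implied; EAC ⇏ SC); `EC(3,2)` stays OPEN; Mantova–Masser's density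
question (PLMS 2024, §1 p. 5) stays OPEN in general.
-/

noncomputable section

open Filter Topology Metric Set Complex
open Literature.ModelTheory.Zilber

set_option linter.dupNamespace false

namespace Summit.Schanuel.Schanuel.Theorems

/-! ## Part A. One corrected root by contraction -/

/-- **A log-corrected root in degree one.**  `α ≠ 0`, `μ ∈ ℝ`, `w ∈ ℂ`, `ρ := ‖w‖/‖α‖ ≥ 1` with
`8(‖α‖ + |μ|(log ρ + 4)) ≤ ‖α‖ρ` and `2|μ|(‖α‖ + |μ|(log ρ + 4)) ≤ ‖α‖²ρ`.  Then there are `z₀, L` with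
`e^{L} = z₀`, **`α z₀ = w + μ L`**, `‖z₀ - w/α‖ ≤ (‖α‖ + |μ|(log ρ + 4))/‖α‖`, `‖L‖ ≤ log ρ + 4` and
`‖z₀‖ ≥ ρ/2` (Banach fixed point of `Φ(z) = ζ₂ + (μ/α) log(z/ζ₁)` on `|z - ζ₂| ≤ 1`). (new) -/
theorem exists_lineRoot_log (α : ℂ) (hα : α ≠ 0) (μ : ℝ) (w : ℂ) (hρ1 : ‖α‖ ≤ ‖w‖)
    (h1 : 8 * (‖α‖ + |μ| * (Real.log (‖w‖ / ‖α‖) + 4)) ≤ ‖α‖ * (‖w‖ / ‖α‖))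
    (h2 : 2 * |μ| * (‖α‖ + |μ| * (Real.log (‖w‖ / ‖α‖) + 4)) ≤ ‖α‖ ^ 2 * (‖w‖ / ‖α‖)) :
    ∃ z₀ L : ℂ, exp L = z₀ ∧ α * z₀ = w + μ * L ∧
      ‖z₀ - w / α‖ ≤ (‖α‖ + |μ| * (Real.log (‖w‖ / ‖α‖) + 4)) / ‖α‖ ∧
      ‖L‖ ≤ Real.log (‖w‖ / ‖α‖) + 4 ∧ ‖w‖ / ‖α‖ / 2 ≤ ‖z₀‖ := by
  have hαpos : 0 < ‖α‖ := norm_pos_iff.2 hα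
  set ρ : ℝ := ‖w‖ / ‖α‖ with hρ
  have hρ1' : 1 ≤ ρ := by rw [hρ, le_div_iff₀ hαpos, one_mul]; exact hρ1
  have hρpos : 0 < ρ := by linarith
  have hlog0 : 0 ≤ Real.log ρ := Real.log_nonneg hρ1'
  have hμ0 : 0 ≤ |μ| := abs_nonneg μ
  set ζ₁ : ℂ := w / α with hζ₁
  have hζ₁norm : ‖ζ₁‖ = ρ := by rw [hζ₁, norm_div]
  have hζ₁0 : ζ₁ ≠ 0 := norm_pos_iff.1 (by rw [hζ₁norm]; exact hρpos)
  set Λ₁ : ℂ := Complex.log ζ₁ with hΛ₁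
  have hΛ₁exp : exp Λ₁ = ζ₁ := Complex.exp_log hζ₁0
  have hΛ₁norm : ‖Λ₁‖ ≤ Real.log ρ + 4 := by
    have h := norm_log_le_of_one_le (z := ζ₁) (by rw [hζ₁norm]; exact hρ1')
    rw [hζ₁norm] at h
    have := Real.pi_lt_four
    linarith
  set r₁ : ℝ := (‖α‖ + |μ| * (Real.log ρ + 4)) / ‖α‖ with hr₁
  have hr₁eq : r₁ = 1 + |μ| * (Real.log ρ + 4) / ‖α‖ := by
    rw [hr₁]; field_simp
  have hr₁1 : 1 ≤ r₁ := by
    rw [hr₁eq]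
    have : 0 ≤ |μ| * (Real.log ρ + 4) / ‖α‖ := by positivity
    linarith
  have hr₁ρ : 8 * r₁ ≤ ρ := by
    rw [hr₁, mul_div_assoc', div_le_iff₀ hαpos]; linarith
  have hμr₁ : 2 * |μ| * r₁ ≤ ‖α‖ * ρ := by
    rw [hr₁, mul_div_assoc', div_le_iff₀ hαpos]; nlinarith
  have hμρ : 4 * |μ| ≤ ‖α‖ * ρ := by nlinarith
  -- the centre `ζ₂` and the disc
  set ζ₂ : ℂ := ζ₁ + (μ : ℂ) / α * Λ₁ with hζ₂
  have hζ₂₁ : ‖ζ₂ - ζ₁‖ ≤ |μ| * (Real.log ρ + 4) / ‖α‖ := by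
    rw [hζ₂, add_sub_cancel_left, norm_mul, norm_div, Complex.norm_real, Real.norm_eq_abs]
    rw [div_mul_eq_mul_div]
    exact div_le_div_of_nonneg_right (mul_le_mul_of_nonneg_left hΛ₁norm hμ0) hαpos.le
  have hB : ∀ z ∈ closedBall ζ₂ 1, ‖z - ζ₁‖ ≤ r₁ ∧ ‖z / ζ₁ - 1‖ ≤ 1 / 8 ∧ ρ / 2 ≤ ‖z‖ := by
    intro z hz
    rw [mem_closedBall, dist_eq_norm] at hz
    have hz1 : ‖z - ζ₁‖ ≤ r₁ := by
      have := norm_sub_le_norm_sub_add_norm_sub z ζ₂ ζ₁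
      rw [hr₁eq]; linarith
    have hv : ‖z / ζ₁ - 1‖ ≤ 1 / 8 := by
      have e : z / ζ₁ - 1 = (z - ζ₁) / ζ₁ := by field_simp
      rw [e, norm_div, hζ₁norm, div_le_iff₀ hρpos]
      linarith
    refine ⟨hz1, hv, ?_⟩
    have := norm_sub_norm_le ζ₁ z
    rw [norm_sub_rev, hζ₁norm] at this
    linarith
  set Φ : ℂ → ℂ := fun z => ζ₂ + (μ : ℂ) / α * Complex.log (z / ζ₁) with hΦ
  have hlogv : ∀ z ∈ closedBall ζ₂ 1, ‖Complex.log (z / ζ₁)‖ ≤ 3 / 2 * ‖z / ζ₁ - 1‖ := by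
    intro z hz
    have h := Complex.norm_log_one_add_half_le_self (z := z / ζ₁ - 1)
      (by linarith [(hB z hz).2.1])
    rwa [add_sub_cancel] at h
  -- `Φ` maps the disc into itself
  have hmaps : MapsTo Φ (closedBall ζ₂ 1) (closedBall ζ₂ 1) := by
    intro z hz
    obtain ⟨hz1, hv, _⟩ := hB z hz
    rw [mem_closedBall, dist_eq_norm]
    have e : Φ z - ζ₂ = (μ : ℂ) / α * Complex.log (z / ζ₁) := by
      simp only [hΦ]; ring
    rw [e, norm_mul, norm_div, Complex.norm_real, Real.norm_eq_abs]
    have hv' : ‖z / ζ₁ - 1‖ ≤ r₁ / ρ := by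
      have e' : z / ζ₁ - 1 = (z - ζ₁) / ζ₁ := by field_simp
      rw [e', norm_div, hζ₁norm]
      exact div_le_div_of_nonneg_right hz1 hρpos.le
    calc |μ| / ‖α‖ * ‖Complex.log (z / ζ₁)‖ ≤ |μ| / ‖α‖ * (3 / 2 * (r₁ / ρ)) :=
          mul_le_mul_of_nonneg_left ((hlogv z hz).trans (by linarith)) (by positivity)
      _ = 3 / 4 * ((2 * |μ| * r₁) / (‖α‖ * ρ)) := by field_simp; ring
      _ ≤ 3 / 4 * 1 := by
          refine mul_le_mul_of_nonneg_left ?_ (by norm_num)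
          rw [div_le_one (by positivity)]; exact hμr₁
      _ ≤ 1 := by norm_num
  -- `Φ` is a `½`-contraction on the disc
  have hlip : LipschitzOnWith (1 / 2 : NNReal) Φ (closedBall ζ₂ 1) := by
    refine (convex_closedBall ζ₂ 1).lipschitzOnWith_of_nnnorm_hasDerivWithin_le
      (f' := fun z => (μ : ℂ) / α * (1 / ζ₁ / (z / ζ₁))) (fun z hz => ?_) (fun z hz => ?_)
    · have hslit : z / ζ₁ ∈ slitPlane := by
        rw [show z / ζ₁ = 1 + (z / ζ₁ - 1) by ring]
        exact mem_slitPlane_of_norm_lt_one (by linarith [(hB z hz).2.1])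
      have hd : HasDerivAt (fun t : ℂ => t / ζ₁) (1 / ζ₁) z := (hasDerivAt_id z).div_const ζ₁
      have h := (((hd.clog hslit).const_mul ((μ : ℂ) / α)).const_add ζ₂).hasDerivWithinAt
        (s := closedBall ζ₂ 1)
      simpa only [hΦ] using h
    · obtain ⟨_, _, hzρ⟩ := hB z hz
      have hz0 : z ≠ 0 := norm_pos_iff.1 (by linarith)
      have e : (μ : ℂ) / α * (1 / ζ₁ / (z / ζ₁)) = (μ : ℂ) / (α * z) := by
        field_simp
      rw [← NNReal.coe_le_coe, coe_nnnorm, e, norm_div, norm_mul, Complex.norm_real,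
        Real.norm_eq_abs]
      push_cast
      rw [div_le_iff₀ (by positivity)]
      nlinarith
  have hcontr : ContractingWith (1 / 2 : NNReal)
      (hmaps.restrict Φ (closedBall ζ₂ 1) (closedBall ζ₂ 1)) :=
    ⟨by rw [← NNReal.coe_lt_coe]; push_cast; norm_num, hlip.mapsToRestrict hmaps⟩
  obtain ⟨z₀, hz₀B, hfix, -⟩ := ContractingWith.exists_fixedPoint' (isClosed_closedBall.isComplete)
    hmaps hcontr (mem_closedBall_self zero_le_one) (edist_ne_top _ _)
  obtain ⟨hz₀1, hv₀, hz₀ρ⟩ := hB z₀ hz₀B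
  have hz₀0 : z₀ ≠ 0 := norm_pos_iff.1 (by linarith)
  have hfix' : Φ z₀ = z₀ := hfix
  refine ⟨z₀, Λ₁ + Complex.log (z₀ / ζ₁), ?_, ?_, ?_, ?_, by simpa [hρ] using hz₀ρ⟩
  · rw [Complex.exp_add, hΛ₁exp, Complex.exp_log (div_ne_zero hz₀0 hζ₁0)]
    field_simp
  · have e : α * Φ z₀ = w + (μ : ℂ) * (Λ₁ + Complex.log (z₀ / ζ₁)) := by
      simp only [hΦ, hζ₂, hζ₁]
      field_simp
      ring
    rw [← e, hfix']
  · simpa [hr₁] using hz₀1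
  · calc ‖Λ₁ + Complex.log (z₀ / ζ₁)‖ ≤ ‖Λ₁‖ + ‖Complex.log (z₀ / ζ₁)‖ := norm_add_le _ _
      _ ≤ (Real.log ρ + Real.pi) + 3 / 2 * (1 / 8) := by
          refine add_le_add ?_ ((hlogv z₀ hz₀B).trans (by linarith))
          have h := norm_log_le_of_one_le (z := ζ₁) (by rw [hζ₁norm]; exact hρ1')
          rwa [hζ₁norm] at h
      _ ≤ Real.log ρ + 4 := by have := Real.pi_lt_d2; linarith

/-! ## Part B. The size hypotheses at all large stages; the root sequence -/

/-- The size hypotheses of `exists_lineRoot_log` hold eventually along any `‖w_k‖ → ∞`. [folklore] -/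
theorem eventually_lineRoot_log_hyp {w : ℕ → ℂ} (hw : Tendsto (fun k => ‖w k‖) atTop atTop)
    {α : ℂ} (hα : α ≠ 0) (μ : ℝ) :
    ∀ᶠ k in atTop, ‖α‖ ≤ ‖w k‖ ∧
      8 * (‖α‖ + |μ| * (Real.log (‖w k‖ / ‖α‖) + 4)) ≤ ‖α‖ * (‖w k‖ / ‖α‖) ∧
      2 * |μ| * (‖α‖ + |μ| * (Real.log (‖w k‖ / ‖α‖) + 4)) ≤ ‖α‖ ^ 2 * (‖w k‖ / ‖α‖) := by
  have hαpos : 0 < ‖α‖ := norm_pos_iff.2 hα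
  have hρ : Tendsto (fun k => ‖w k‖ / ‖α‖) atTop atTop := hw.atTop_div_const hαpos
  have hμ0 : 0 ≤ |μ| := abs_nonneg μ
  -- `log ρ ≤ c ρ` eventually, `c` small
  set c : ℝ := ‖α‖ ^ 2 / (16 * (‖α‖ + 1) * (|μ| + 1) ^ 2) with hc
  have hcpos : 0 < c := by positivity
  have hlog : ∀ᶠ x : ℝ in atTop, Real.log x ≤ c * x := by
    have h := Real.isLittleO_log_id_atTop.bound hcpos
    filter_upwards [h, eventually_ge_atTop (1 : ℝ)] with x hx hx1
    simp only [Real.norm_eq_abs, id] at hx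
    rw [abs_of_nonneg (by linarith : (0 : ℝ) ≤ x)] at hx
    exact (le_abs_self _).trans hx
  have hev1 := hρ.eventually hlog
  have hev2 := hρ.eventually_ge_atTop (16 * (‖α‖ + 4 * |μ| + 1) / ‖α‖ + 8 * |μ| * (‖α‖ + 4 * |μ|) / ‖α‖ ^ 2)
  have hev3 := hw.eventually_ge_atTop ‖α‖
  filter_upwards [hev1, hev2, hev3] with k h1 h2 h3
  set ρ := ‖w k‖ / ‖α‖ with hρdef
  have hρ0 : 0 ≤ ρ := by positivity
  have hA : 16 * (‖α‖ + 4 * |μ| + 1) / ‖α‖ ≤ ρ :=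
    le_trans (le_add_of_nonneg_right (by positivity)) h2
  have hB : 8 * |μ| * (‖α‖ + 4 * |μ|) / ‖α‖ ^ 2 ≤ ρ :=
    le_trans (le_add_of_nonneg_left (by positivity)) h2
  rw [div_le_iff₀ hαpos] at hA
  rw [div_le_iff₀ (by positivity)] at hB
  -- `|μ| log ρ ≤ |μ| c ρ ≤ ‖α‖ ρ / 16` and `μ² log ρ ≤ ‖α‖² ρ / 16`
  have hc1 : 8 * |μ| * c ≤ ‖α‖ / 2 := by
    rw [hc]
    have hden : 0 < 16 * (‖α‖ + 1) * (|μ| + 1) ^ 2 := by positivity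
    rw [show 8 * |μ| * (‖α‖ ^ 2 / (16 * (‖α‖ + 1) * (|μ| + 1) ^ 2)) =
      (8 * |μ| * ‖α‖ ^ 2) / (16 * (‖α‖ + 1) * (|μ| + 1) ^ 2) by ring, div_le_iff₀ hden]
    nlinarith [mul_nonneg hμ0 hαpos.le, mul_nonneg (mul_nonneg hμ0 hμ0) hαpos.le, sq_nonneg ‖α‖,
      mul_nonneg hμ0 (sq_nonneg ‖α‖)]
  have hc2 : 2 * |μ| * |μ| * c ≤ ‖α‖ ^ 2 / 8 := by
    rw [hc]
    have hden : 0 < 16 * (‖α‖ + 1) * (|μ| + 1) ^ 2 := by positivity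
    rw [show 2 * |μ| * |μ| * (‖α‖ ^ 2 / (16 * (‖α‖ + 1) * (|μ| + 1) ^ 2)) =
      (2 * |μ| * |μ| * ‖α‖ ^ 2) / (16 * (‖α‖ + 1) * (|μ| + 1) ^ 2) by ring, div_le_iff₀ hden]
    nlinarith [mul_nonneg hμ0 hαpos.le, mul_nonneg (mul_nonneg hμ0 hμ0) (sq_nonneg ‖α‖),
      sq_nonneg ‖α‖, mul_nonneg hμ0 (sq_nonneg ‖α‖), hαpos.le]
  have hlogρ : Real.log ρ ≤ c * ρ := h1
  refine ⟨h3, ?_, ?_⟩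
  · have : 8 * |μ| * Real.log ρ ≤ ‖α‖ / 2 * ρ := by
      calc 8 * |μ| * Real.log ρ ≤ 8 * |μ| * (c * ρ) := mul_le_mul_of_nonneg_left hlogρ (by positivity)
        _ = (8 * |μ| * c) * ρ := by ring
        _ ≤ ‖α‖ / 2 * ρ := mul_le_mul_of_nonneg_right hc1 hρ0
    nlinarith
  · have : 2 * |μ| * |μ| * Real.log ρ ≤ ‖α‖ ^ 2 / 8 * ρ := by
      calc 2 * |μ| * |μ| * Real.log ρ ≤ 2 * |μ| * |μ| * (c * ρ) :=
            mul_le_mul_of_nonneg_left hlogρ (by positivity)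
        _ = (2 * |μ| * |μ| * c) * ρ := by ring
        _ ≤ ‖α‖ ^ 2 / 8 * ρ := mul_le_mul_of_nonneg_right hc2 hρ0
    nlinarith

/-- **The sequence of degree-one corrected roots.**  `α ≠ 0`, `β, c₀ ∈ ℂ`, `μ ∈ ℝ`, `s = ±1`:
there are `K₀` and `z₀(k), L(k)` with `e^{L(k)} = z₀(k)`,
**`α z₀(k) + β = (k + K₀ + 1)s · 2πi + c₀ + μ L(k)`**, and, with
`w_k = (k + K₀ + 1)s · 2πi + c₀ - β`: `‖α‖ ≤ ‖w_k‖`,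
`‖z₀(k) - w_k/α‖ ≤ (‖α‖ + |μ|(log(‖w_k‖/‖α‖) + 4))/‖α‖`, `‖L(k)‖ ≤ log(‖w_k‖/‖α‖) + 4`,
`‖z₀(k)‖ ≥ ‖w_k‖/(2‖α‖)`, `|‖w_k‖ - 2π(k + K₀ + 1)| ≤ ‖c₀ - β‖`. (new) -/
theorem exists_lineRoot_log_seq (α : ℂ) (hα : α ≠ 0) (β c₀ : ℂ) (μ : ℝ) (s : ℤ)
    (hs : s = 1 ∨ s = -1) :
    ∃ (K₀ : ℕ) (z₀ Lg : ℕ → ℂ), ∀ k,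
      exp (Lg k) = z₀ k ∧
      α * z₀ k + β = (((k + K₀ + 1 : ℕ) : ℤ) * s : ℤ) * (2 * Real.pi * I) + c₀ + μ * Lg k ∧
      ‖α‖ ≤ ‖((((k + K₀ + 1 : ℕ) : ℤ) * s : ℤ) : ℂ) * (2 * Real.pi * I) + c₀ - β‖ ∧
      ‖z₀ k - ((((( k + K₀ + 1 : ℕ) : ℤ) * s : ℤ) : ℂ) * (2 * Real.pi * I) + c₀ - β) / α‖ ≤
        (‖α‖ + |μ| * (Real.log (‖((((k + K₀ + 1 : ℕ) : ℤ) * s : ℤ) : ℂ) * (2 * Real.pi * I) +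
          c₀ - β‖ / ‖α‖) + 4)) / ‖α‖ ∧
      ‖Lg k‖ ≤ Real.log (‖((((k + K₀ + 1 : ℕ) : ℤ) * s : ℤ) : ℂ) * (2 * Real.pi * I) + c₀ - β‖ /
        ‖α‖) + 4 ∧
      ‖((((k + K₀ + 1 : ℕ) : ℤ) * s : ℤ) : ℂ) * (2 * Real.pi * I) + c₀ - β‖ / ‖α‖ / 2 ≤ ‖z₀ k‖ ∧
      2 * Real.pi * (((k + K₀ : ℕ) : ℝ) + 1) - ‖c₀ - β‖ ≤
        ‖((((k + K₀ + 1 : ℕ) : ℤ) * s : ℤ) : ℂ) * (2 * Real.pi * I) + c₀ - β‖ ∧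
      ‖((((k + K₀ + 1 : ℕ) : ℤ) * s : ℤ) : ℂ) * (2 * Real.pi * I) + c₀ - β‖ ≤
        2 * Real.pi * (((k + K₀ : ℕ) : ℝ) + 1) + ‖c₀ - β‖ := by
  set w : ℕ → ℂ := fun n => ((((n + 1 : ℕ) : ℤ) * s : ℤ) : ℂ) * (2 * Real.pi * I) + c₀ - β
    with hw
  -- `‖w n‖ ≥ 2π(n+1) - ‖c₀ - β‖ → ∞`
  have hwn : ∀ n : ℕ, 2 * Real.pi * ((n : ℝ) + 1) - ‖c₀ - β‖ ≤ ‖w n‖ ∧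
      ‖w n‖ ≤ 2 * Real.pi * ((n : ℝ) + 1) + ‖c₀ - β‖ := by
    intro n
    have hsn : ‖(s : ℂ)‖ = 1 := by rcases hs with rfl | rfl <;> simp
    have h1 : ‖((((n + 1 : ℕ) : ℤ) * s : ℤ) : ℂ) * (2 * Real.pi * I)‖ = 2 * Real.pi * ((n : ℝ) + 1) := by
      push_cast
      rw [norm_mul, norm_mul, hsn, mul_one]
      have e1 : ‖((n : ℂ) + 1)‖ = (n : ℝ) + 1 := by
        rw [show ((n : ℂ) + 1) = (((n : ℝ) + 1 : ℝ) : ℂ) by push_cast; ring, Complex.norm_real,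
          Real.norm_eq_abs, abs_of_nonneg (by positivity)]
      rw [e1, norm_mul, norm_mul, Complex.norm_I, Complex.norm_real, Complex.norm_ofNat,
        Real.norm_eq_abs, abs_of_pos Real.pi_pos]
      ring
    have h2 := norm_sub_norm_le (((((n + 1 : ℕ) : ℤ) * s : ℤ) : ℂ) * (2 * Real.pi * I)) (-(c₀ - β))
    have h3 := norm_sub_le (((((n + 1 : ℕ) : ℤ) * s : ℤ) : ℂ) * (2 * Real.pi * I)) (-(c₀ - β))
    rw [norm_neg, h1] at h2 h3
    have e2 : ((((n + 1 : ℕ) : ℤ) * s : ℤ) : ℂ) * (2 * Real.pi * I) - -(c₀ - β) = w n := by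
      simp only [hw]; ring
    rw [e2] at h2 h3
    exact ⟨by linarith, h3⟩
  have hwt : Tendsto (fun n => ‖w n‖) atTop atTop := by
    refine tendsto_atTop_mono (fun n => (hwn n).1) ?_
    refine tendsto_atTop_add_const_right _ _ ?_
    exact (tendsto_natCast_add_atTop 1).const_mul_atTop Real.two_pi_pos
  obtain ⟨K₀, hK₀⟩ := eventually_atTop.1 (eventually_lineRoot_log_hyp hwt hα μ)
  have hroot : ∀ k : ℕ, ∃ z₀ L : ℂ, exp L = z₀ ∧ α * z₀ = w (k + K₀) + μ * L ∧
      ‖z₀ - w (k + K₀) / α‖ ≤ (‖α‖ + |μ| * (Real.log (‖w (k + K₀)‖ / ‖α‖) + 4)) / ‖α‖ ∧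
      ‖L‖ ≤ Real.log (‖w (k + K₀)‖ / ‖α‖) + 4 ∧ ‖w (k + K₀)‖ / ‖α‖ / 2 ≤ ‖z₀‖ := by
    intro k
    obtain ⟨h1, h2, h3⟩ := hK₀ (k + K₀) (Nat.le_add_left _ _)
    exact exists_lineRoot_log α hα μ (w (k + K₀)) h1 h2 h3
  choose z₀ Lg hLz hz₀ hdist hLn hbig using hroot
  refine ⟨K₀, z₀, Lg, fun k => ⟨hLz k, ?_, (hK₀ (k + K₀) (Nat.le_add_left _ _)).1, hdist k, hLn k,
    hbig k, (hwn (k + K₀)).1, (hwn (k + K₀)).2⟩⟩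
  have := hz₀ k
  simp only [hw] at this
  linear_combination this

end Summit.Schanuel.Schanuel.Theorems
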